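import Summits.SmoothPoincare4.SmoothPoincare4.Theorems.CongruenceShadowsAgkCor6SufficiencyStubSeamFormCalc
import Literature.Topology.FourManifolds.TrisectionsAmbientMorseLemmas

/-!
# Helpers for stub `stub_seamForm` of line `lp-by-sphere-system-surgery` (crux `AgkCor6Sufficiency`,
item stmt-SmoothPoincare4-10894, routes CongruenceShadows / GroupTrisection; lead reshape r5, A3):
the local model at a regular seam point

Calculus in the model space `ℝ⁴` for the seam normalisation, read in a half-slice chart of the
reference sector at a seam point (so that the reference sector is `{z₀ ≥ 0}` and the seam is the
hyperplane `{z₀ = 0}`).  There the transverse seam coordinate `σ = G_ref - 1` satisfies `σ ≤ 0`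
on `{z₀ ≥ 0}`, `σ = 0` on `{z₀ = 0}`, `dσ ≠ 0`, and the normalised presentation `g = G_norm`
satisfies `g ≤ 1` on `{z₀ ≤ 0}`, `g = 1` on `{z₀ = 0}`, `dg ≠ 0`.  We prove
(`stub_seamFormModelToolkit : SeamFormModelToolkit`):

* `sign_fderiv_e0`: Fermat's one-sided lemma — the normal derivative `∂₀σ` is `< 0` (and
  `∂₀g > 0`): the tangential derivatives vanish, `dσ ≠ 0`, and `σ` has a one-sided maximum;
* `localModel`: on a ball about the seam point, `sign σ = -sign z₀`, `dσ ≠ 0`, `dg ≠ 0`, and for every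
  plateau `ψ` with `|tψ'(t)| ≤ η` (`η` depending only on the point) the modified function
  `g + ψ(σ)(1 - σ - g)` has nonzero derivative: along `e₀` it is
  `(1 - ψ)∂₀g - ψ ∂₀σ + ψ'(σ)∂₀σ · D ≥ min(α, β) - 3M|σψ'(σ)| > 0`, where `∂₀g ≥ α`,
  `∂₀σ ≤ -β`, `|D| = |1 - σ - g| ≤ M|z₀| ≤ (M/β)|σ|` by the mean value theorem.

## References

* A. Abrams, D. Gay, R. Kirby, *Group trisections and smooth 4-manifolds*, Geom. Topol. 22
  (2018), proof of Thm. 5. [AbramsGayKirby2018]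
* J. Milnor, *Lectures on the h-cobordism theorem* (1965), §3 (functions near a regular
  hypersurface). [Milnor1965]
-/

noncomputable section

-- the prescribed namespace `Summit.<P>.<Sub>.…` duplicates `SmoothPoincare4` (P = Sub)
set_option linter.dupNamespace false

open Set Function Filter Metric
open scoped Manifold ContDiff Topology

namespace Summit.SmoothPoincare4.SmoothPoincare4.Cruxes.AgkCor6Sufficiency.LpBySphereSystemSurgery

open Literature.Topology.FourManifolds

/-! ## Fermat's one-sided lemma -/

/-- **Sign of the normal derivative at a one-sided extremum on a hyperplane.**  Let `F` be
differentiable at `zc` (`zc₀ = 0`) in the open `Tg`, `F ≤ c` on `Tg ∩ {s z₀ ≥ 0}` (`s = ±1`),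
`F = c` on `Tg ∩ {z₀ = 0}` and `dF(zc) ≠ 0`.  Then `s ∂₀F(zc) < 0`: the tangential derivatives
vanish (so `∂₀F(zc) ≠ 0`) and `dF(zc)(s e₀) ≤ 0` by Fermat's lemma for the one-sided maximum.
[folklore] -/
theorem sign_fderiv_e0 {F : EuclideanSpace ℝ (Fin 4) → ℝ} {Tg : Set (EuclideanSpace ℝ (Fin 4))}
    (hTg : IsOpen Tg) {zc : EuclideanSpace ℝ (Fin 4)} (hzc : zc ∈ Tg) (hzc0 : zc 0 = 0)
    (hF : DifferentiableAt ℝ F zc) {s c : ℝ} (hs : s = 1 ∨ s = -1)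
    (hle : ∀ z ∈ Tg, 0 ≤ s * z 0 → F z ≤ c) (heq : ∀ z ∈ Tg, z 0 = 0 → F z = c)
    (hF' : fderiv ℝ F zc ≠ 0) : s * fderiv ℝ F zc e0 < 0 := by
  have hs0 : s ≠ 0 := by rcases hs with rfl | rfl <;> norm_num
  have hFzc : F zc = c := heq zc hzc hzc0
  -- tangential derivatives vanish
  have htan : ∀ i : Fin 4, i ≠ 0 → fderiv ℝ F zc (EuclideanSpace.single i 1) = 0 := by
    intro i hi
    set v : EuclideanSpace ℝ (Fin 4) := EuclideanSpace.single i 1 with hv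
    have hline : HasDerivAt (fun t : ℝ => F (zc + t • v)) (fderiv ℝ F zc v) 0 := by
      have h := hF.hasFDerivAt.hasLineDerivAt v
      exact h
    have hconst : ∀ᶠ t in 𝓝 (0:ℝ), F (zc + t • v) = c := by
      have hcont : Continuous fun t : ℝ => zc + t • v := by fun_prop
      have hlim : Tendsto (fun t : ℝ => zc + t • v) (𝓝 0) (𝓝 zc) := by simpa using hcont.tendsto 0
      filter_upwards [hlim.eventually (hTg.mem_nhds hzc)] with t ht
      exact heq _ ht (by simp [hv, hi.symm, hzc0])
    have hzero : HasDerivAt (fun t : ℝ => F (zc + t • v)) 0 0 :=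
      (hasDerivAt_const (0:ℝ) c).congr_of_eventuallyEq hconst
    exact hline.unique hzero
  -- hence the normal derivative is nonzero
  have hne : fderiv ℝ F zc e0 ≠ 0 := by
    intro h0
    apply hF'
    have : (fderiv ℝ F zc : EuclideanSpace ℝ (Fin 4) →ₗ[ℝ] ℝ) = 0 :=
      (EuclideanSpace.basisFun (Fin 4) ℝ).toBasis.ext fun i => by
        by_cases hi : i = 0
        · subst hi; simpa [e0] using h0
        · simpa using htan i hi
    exact ContinuousLinearMap.coe_injective this
  -- the one-sided maximum
  obtain ⟨ρ, hρ, hball⟩ := Metric.isOpen_iff.1 hTg zc hzc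
  set S' : Set (EuclideanSpace ℝ (Fin 4)) := {z | z ∈ Tg ∧ 0 ≤ s * z 0} with hS'
  have hmax : IsLocalMaxOn F S' zc := by
    refine Filter.mem_of_superset self_mem_nhdsWithin fun z hz => ?_
    show F z ≤ F zc
    rw [hFzc]; exact hle z hz.1 hz.2
  have hderiv : HasFDerivWithinAt F (fderiv ℝ F zc) S' zc := hF.hasFDerivAt.hasFDerivWithinAt
  have hy : ((ρ / 2 * s) • e0 : EuclideanSpace ℝ (Fin 4)) ∈ posTangentConeAt S' zc := by
    apply mem_posTangentConeAt_of_segment_subset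
    intro w hw
    rw [segment_eq_image'] at hw
    obtain ⟨θ, ⟨hθ0, hθ1⟩, rfl⟩ := hw
    simp only [add_sub_cancel_left]
    constructor
    · apply hball
      have hnorm : ‖e0‖ = 1 := by simp [e0]
      have habs : |s| = 1 := by rcases hs with rfl | rfl <;> norm_num
      rw [Metric.mem_ball, dist_eq_norm, add_sub_cancel_left, norm_smul, norm_smul, hnorm,
        Real.norm_eq_abs, Real.norm_eq_abs, mul_one, abs_of_nonneg hθ0, abs_mul,
        abs_of_pos (half_pos hρ), habs, mul_one]
      nlinarith
    · show 0 ≤ s * (zc + θ • ((ρ / 2 * s) • e0)) 0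
      have h1 : (zc + θ • ((ρ / 2 * s) • e0)) 0 = θ * (ρ / 2 * s) := by simp [e0, hzc0]
      have hss : s * s = 1 := by rcases hs with rfl | rfl <;> norm_num
      have h2 : s * (θ * (ρ / 2 * s)) = θ * (ρ / 2) * (s * s) := by ring
      rw [h1, h2, hss, mul_one]
      positivity
  have hnonpos := hmax.hasFDerivWithinAt_nonpos hderiv hy
  rw [map_smul, smul_eq_mul] at hnonpos
  have hle' : s * fderiv ℝ F zc e0 ≤ 0 := by nlinarith
  exact lt_of_le_of_ne hle' (mul_ne_zero hs0 hne)

/-! ## The local model -/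

/-- **The local model of the seam normalisation at a regular seam point.**  In the open `Tg ∋ zc`
(`zc₀ = 0`) let `σ, g` be `C¹` with `σ ≤ 0` on `{z₀ ≥ 0}`, `σ = 0` on `{z₀ = 0}`, `dσ(zc) ≠ 0`,
`g ≤ 1` on `{z₀ ≤ 0}`, `g = 1` on `{z₀ = 0}`, `dg(zc) ≠ 0`.  Then on a ball `B ⊆ Tg` about `zc`:
`σ = 0` exactly on the hyperplane, `σ > 0` on `{z₀ < 0}`, `σ < 0` on `{z₀ > 0}`, `dσ ≠ 0`,
`dg ≠ 0`; and
there is `η > 0` such that for every differentiable plateau `ψ` (values in `[0, 1]`,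
`|tψ'(t)| ≤ η`) every function agreeing near a point `z ∈ B` with `g + ψ(σ)(1 - σ - g)` has
nonzero derivative at `z`. [cite: AbramsGayKirby2018, proof of Thm. 5] -/
theorem localModel {σ g : EuclideanSpace ℝ (Fin 4) → ℝ} {Tg : Set (EuclideanSpace ℝ (Fin 4))}
    (hTg : IsOpen Tg) {zc : EuclideanSpace ℝ (Fin 4)} (hzc : zc ∈ Tg) (hzc0 : zc 0 = 0)
    (hσ : ContDiffOn ℝ 1 σ Tg) (hg : ContDiffOn ℝ 1 g Tg)
    (hσle : ∀ z ∈ Tg, 0 ≤ z 0 → σ z ≤ 0) (hσ0 : ∀ z ∈ Tg, z 0 = 0 → σ z = 0)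
    (hσ' : fderiv ℝ σ zc ≠ 0) (hgle : ∀ z ∈ Tg, z 0 ≤ 0 → g z ≤ 1)
    (hg1 : ∀ z ∈ Tg, z 0 = 0 → g z = 1) (hg' : fderiv ℝ g zc ≠ 0) :
    ∃ r : ℝ, 0 < r ∧ ball zc r ⊆ Tg ∧ ∃ η : ℝ, 0 < η ∧
      (∀ z ∈ ball zc r, (σ z = 0 ↔ z 0 = 0) ∧ (z 0 < 0 → 0 < σ z) ∧ (0 < z 0 → σ z < 0) ∧
        fderiv ℝ σ z ≠ 0 ∧ fderiv ℝ g z ≠ 0) ∧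
      (∀ ψ : ℝ → ℝ, Differentiable ℝ ψ → (∀ t, 0 ≤ ψ t ∧ ψ t ≤ 1) →
        (∀ t, |t * deriv ψ t| ≤ η) → ∀ z ∈ ball zc r, ∀ f : EuclideanSpace ℝ (Fin 4) → ℝ,
        DifferentiableAt ℝ f z → (f =ᶠ[𝓝 z] fun w => g w + ψ (σ w) * (1 - σ w - g w)) →
        fderiv ℝ f z ≠ 0) := by
  -- ### differentiability, the normal derivatives and their continuity
  have hσd : ∀ z ∈ Tg, DifferentiableAt ℝ σ z := fun z hz =>
    ((hσ z hz).contDiffAt (hTg.mem_nhds hz)).differentiableAt (by simp)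
  have hgd : ∀ z ∈ Tg, DifferentiableAt ℝ g z := fun z hz =>
    ((hg z hz).contDiffAt (hTg.mem_nhds hz)).differentiableAt (by simp)
  obtain ⟨σ', hσ'def⟩ : ∃ σ' : EuclideanSpace ℝ (Fin 4) → ℝ, σ' = fun z => fderiv ℝ σ z e0 :=
    ⟨_, rfl⟩
  obtain ⟨g', hg'def⟩ : ∃ g' : EuclideanSpace ℝ (Fin 4) → ℝ, g' = fun z => fderiv ℝ g z e0 :=
    ⟨_, rfl⟩
  have hσ'ap : ∀ z, fderiv ℝ σ z e0 = σ' z := fun z => by rw [hσ'def]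
  have hg'ap : ∀ z, fderiv ℝ g z e0 = g' z := fun z => by rw [hg'def]
  have hσ'c : ContinuousOn σ' Tg := by
    rw [hσ'def]
    exact (hσ.continuousOn_fderiv_of_isOpen hTg le_rfl).clm_apply continuousOn_const
  have hg'c : ContinuousOn g' Tg := by
    rw [hg'def]
    exact (hg.continuousOn_fderiv_of_isOpen hTg le_rfl).clm_apply continuousOn_const
  -- ### signs at `zc`
  have hσ'neg : σ' zc < 0 := by
    have h := sign_fderiv_e0 hTg hzc hzc0 (hσd zc hzc) (Or.inl rfl) (c := 0)
      (fun z hz h0 => hσle z hz (by simpa using h0)) hσ0 hσ'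
    rw [hσ'ap] at h; simpa using h
  have hg'pos : 0 < g' zc := by
    have h := sign_fderiv_e0 hTg hzc hzc0 (hgd zc hzc) (Or.inr rfl) (c := 1)
      (fun z hz h0 => hgle z hz (by linarith)) hg1 hg'
    rw [hg'ap] at h; linarith
  set β : ℝ := -σ' zc / 2 with hβ
  set α : ℝ := g' zc / 2 with hα
  have hβpos : 0 < β := by rw [hβ]; linarith
  have hαpos : 0 < α := half_pos hg'pos
  -- ### the radius
  obtain ⟨r, hr, hball⟩ : ∃ r > 0, ∀ z ∈ ball zc r,
      z ∈ Tg ∧ dist (σ' z) (σ' zc) < β ∧ dist (g' z) (g' zc) < α := by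
    have h1 : ∀ᶠ z in 𝓝 zc, z ∈ Tg := hTg.mem_nhds hzc
    have h2 : ∀ᶠ z in 𝓝 zc, dist (σ' z) (σ' zc) < β :=
      (hσ'c.continuousAt (hTg.mem_nhds hzc)).eventually_mem (ball_mem_nhds _ hβpos)
    have h3 : ∀ᶠ z in 𝓝 zc, dist (g' z) (g' zc) < α :=
      (hg'c.continuousAt (hTg.mem_nhds hzc)).eventually_mem (ball_mem_nhds _ hαpos)
    exact Metric.eventually_nhds_iff_ball.1 (h1.and (h2.and h3))
  have hbT : ball zc r ⊆ Tg := fun z hz => (hball z hz).1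
  have hσ'b : ∀ z ∈ ball zc r, σ' z ≤ -β ∧ |σ' z| ≤ 3 * β := by
    intro z hz
    have h := (hball z hz).2.1
    rw [Real.dist_eq, abs_lt] at h
    have h1 : σ' z ≤ -β := by rw [hβ]; linarith [h.2]
    refine ⟨h1, ?_⟩
    rw [abs_of_neg (by linarith)]
    rw [hβ]; linarith [h.1]
  have hg'b : ∀ z ∈ ball zc r, α ≤ g' z ∧ |g' z| ≤ 3 * α := by
    intro z hz
    have h := (hball z hz).2.2
    rw [Real.dist_eq, abs_lt] at h
    have h1 : α ≤ g' z := by rw [hα]; linarith [h.1]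
    refine ⟨h1, ?_⟩
    rw [abs_of_pos (by linarith)]
    rw [hα]; linarith [h.2]
  set M : ℝ := 3 * β + 3 * α with hM
  have hMpos : 0 < M := by positivity
  have hμ : 0 < min α β := lt_min hαpos hβpos
  set η : ℝ := min α β / (6 * M + 2) with hη
  have hηpos : 0 < η := by positivity
  have h3Mη : 3 * M * η < min α β := by
    have h1 : 3 * M * η = min α β * (3 * M / (6 * M + 2)) := by rw [hη]; ring
    rw [h1]
    exact mul_lt_of_lt_one_right hμ ((div_lt_one (by positivity)).2 (by linarith))
  -- ### derivatives on the ball and the mean value theorem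
  have hσF : ∀ w ∈ ball zc r, HasFDerivAt σ (fderiv ℝ σ w) w := fun w hw =>
    (hσd w (hbT hw)).hasFDerivAt
  have hgF : ∀ w ∈ ball zc r, HasFDerivAt g (fderiv ℝ g w) w := fun w hw =>
    (hgd w (hbT hw)).hasFDerivAt
  have hDF : ∀ w ∈ ball zc r, HasFDerivAt (fun w => 1 - σ w - g w)
      ((0 : EuclideanSpace ℝ (Fin 4) →L[ℝ] ℝ) - fderiv ℝ σ w - fderiv ℝ g w) w := fun w hw =>
    ((hasFDerivAt_const (1:ℝ) w).sub (hσF w hw)).sub (hgF w hw)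
  have hproj : ∀ z ∈ ball zc r, z + (-(z 0)) • e0 ∈ ball zc r ∧ (z + (-(z 0)) • e0) 0 = 0 := by
    intro z hz
    refine ⟨?_, by simp [e0]⟩
    rw [Metric.mem_ball] at hz ⊢
    exact lt_of_le_of_lt (dist_add_smul_e0_le hzc0 (by simp)) hz
  have hσMVT : ∀ z ∈ ball zc r, ∃ ξ ∈ ball zc r, σ z = σ' ξ * z 0 := by
    intro z hz
    obtain ⟨ξ, hξ, heq⟩ := exists_lineMVT hzc0 hσF hz
    refine ⟨ξ, hξ, ?_⟩
    have h0 : σ (z + (-(z 0)) • e0) = 0 := hσ0 _ (hbT (hproj z hz).1) (hproj z hz).2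
    rw [h0, sub_zero, hσ'ap] at heq
    exact heq
  have hDMVT : ∀ z ∈ ball zc r, |1 - σ z - g z| ≤ M * |z 0| := by
    intro z hz
    obtain ⟨ξ, hξ, heq⟩ := exists_lineMVT hzc0 hDF hz
    have h0 : 1 - σ (z + (-(z 0)) • e0) - g (z + (-(z 0)) • e0) = 0 := by
      rw [hσ0 _ (hbT (hproj z hz).1) (hproj z hz).2, hg1 _ (hbT (hproj z hz).1) (hproj z hz).2]
      ring
    rw [h0, sub_zero] at heq
    rw [heq]
    have h1 : ((0 : EuclideanSpace ℝ (Fin 4) →L[ℝ] ℝ) - fderiv ℝ σ ξ - fderiv ℝ g ξ) e0 =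
        -σ' ξ - g' ξ := by
      show (0 : ℝ) - fderiv ℝ σ ξ e0 - fderiv ℝ g ξ e0 = -σ' ξ - g' ξ
      rw [hσ'ap, hg'ap]; ring
    rw [h1, abs_mul]
    have h2 : |-σ' ξ - g' ξ| ≤ M := by
      calc |-σ' ξ - g' ξ| ≤ |-σ' ξ| + |g' ξ| := abs_sub _ _
        _ = |σ' ξ| + |g' ξ| := by rw [abs_neg]
        _ ≤ 3 * β + 3 * α := add_le_add (hσ'b ξ hξ).2 (hg'b ξ hξ).2
    exact mul_le_mul_of_nonneg_right h2 (abs_nonneg _)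
  refine ⟨r, hr, hbT, η, hηpos, ?_, ?_⟩
  · -- ### the sign of `σ` and its regularity
    intro z hz
    obtain ⟨ξ, hξ, heq⟩ := hσMVT z hz
    have hσ'ξ : σ' ξ < 0 := by linarith [(hσ'b ξ hξ).1]
    refine ⟨⟨fun h => ?_, fun h => hσ0 z (hbT hz) h⟩, fun h => ?_, fun h => ?_, fun h0 => ?_,
      fun h0 => ?_⟩
    · rw [heq] at h
      rcases mul_eq_zero.1 h with h' | h'
      · exact absurd h' hσ'ξ.ne
      · exact h'
    · rw [heq]; exact mul_pos_of_neg_of_neg hσ'ξ h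
    · rw [heq]; exact mul_neg_of_neg_of_pos hσ'ξ h
    · have h1 := (hσ'b z hz).1
      have h2 : σ' z = 0 := by rw [← hσ'ap, h0]; rfl
      linarith
    · have h1 := (hg'b z hz).1
      have h2 : g' z = 0 := by rw [← hg'ap, h0]; rfl
      linarith
  · -- ### no critical points of the modified function
    intro ψ hψd hψ01 hψη z hz f hf hfeq
    -- the derivative along the normal line
    have hL : HasDerivAt (fun s : ℝ => z + s • e0) e0 0 := by
      simpa using ((hasDerivAt_id (0:ℝ)).smul_const e0).const_add z
    have hz0 : z + (0:ℝ) • e0 = z := by simp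
    have hσL : HasDerivAt (fun s : ℝ => σ (z + s • e0)) (σ' z) 0 := by
      have h : HasFDerivAt σ (fderiv ℝ σ z) (z + (0:ℝ) • e0) := by rw [hz0]; exact hσF z hz
      have := h.comp_hasDerivAt (0:ℝ) hL
      rwa [hσ'ap] at this
    have hgL : HasDerivAt (fun s : ℝ => g (z + s • e0)) (g' z) 0 := by
      have h : HasFDerivAt g (fderiv ℝ g z) (z + (0:ℝ) • e0) := by rw [hz0]; exact hgF z hz
      have := h.comp_hasDerivAt (0:ℝ) hL
      rwa [hg'ap] at this
    have hψL : HasDerivAt (fun s : ℝ => ψ (σ (z + s • e0))) (deriv ψ (σ z) * σ' z) 0 := by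
      have h : HasDerivAt ψ (deriv ψ (σ z)) (σ (z + (0:ℝ) • e0)) := by
        rw [hz0]; exact (hψd _).hasDerivAt
      exact h.comp 0 hσL
    have hDL : HasDerivAt (fun s : ℝ => 1 - σ (z + s • e0) - g (z + s • e0)) (-σ' z - g' z) 0 :=
      ((hσL.const_sub 1).fun_sub hgL).congr_deriv (by ring)
    have hHL := hgL.fun_add (hψL.fun_mul hDL)
    rw [hz0] at hHL
    set val : ℝ := g' z + (deriv ψ (σ z) * σ' z * (1 - σ z - g z) +
      ψ (σ z) * (-σ' z - g' z)) with hval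
    -- ### positivity of the line derivative
    have hvalpos : 0 < val := by
      obtain ⟨ξ, hξ, hσeq⟩ := hσMVT z hz
      have hβz : β * |z 0| ≤ |σ z| := by
        rw [hσeq, abs_mul]
        have h1 : β ≤ |σ' ξ| := by
          rw [abs_of_neg (by linarith [(hσ'b ξ hξ).1])]; linarith [(hσ'b ξ hξ).1]
        exact mul_le_mul_of_nonneg_right h1 (abs_nonneg _)
      have hD := hDMVT z hz
      have hE : |deriv ψ (σ z) * σ' z * (1 - σ z - g z)| ≤ 3 * M * η := by
        rw [abs_mul, abs_mul]
        have h1 : |σ' z| ≤ 3 * β := (hσ'b z hz).2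
        have h2 := hψη (σ z)
        calc |deriv ψ (σ z)| * |σ' z| * |1 - σ z - g z|
            ≤ |deriv ψ (σ z)| * (3 * β) * (M * |z 0|) := by gcongr
          _ = 3 * M * (|deriv ψ (σ z)| * (β * |z 0|)) := by ring
          _ ≤ 3 * M * (|deriv ψ (σ z)| * |σ z|) := by gcongr
          _ = 3 * M * |σ z * deriv ψ (σ z)| := by rw [abs_mul, mul_comm |σ z|]
          _ ≤ 3 * M * η := by gcongr
      have hmain : min α β ≤ (1 - ψ (σ z)) * g' z + ψ (σ z) * (-σ' z) := by
        obtain ⟨h0, h1⟩ := hψ01 (σ z)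
        have ha : min α β ≤ g' z := (min_le_left α β).trans (hg'b z hz).1
        have hb : min α β ≤ -σ' z := (min_le_right α β).trans (by linarith [(hσ'b z hz).1])
        have e1 : (1 - ψ (σ z)) * min α β ≤ (1 - ψ (σ z)) * g' z :=
          mul_le_mul_of_nonneg_left ha (sub_nonneg.2 h1)
        have e2 : ψ (σ z) * min α β ≤ ψ (σ z) * (-σ' z) := mul_le_mul_of_nonneg_left hb h0
        nlinarith [e1, e2]
      have hsplit : val = ((1 - ψ (σ z)) * g' z + ψ (σ z) * (-σ' z)) +
          deriv ψ (σ z) * σ' z * (1 - σ z - g z) := by rw [hval]; ring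
      have hE' := neg_abs_le (deriv ψ (σ z) * σ' z * (1 - σ z - g z))
      linarith
    -- ### conclusion
    refine fderiv_ne_zero_of_eventuallyEq_line (v := e0) hf hHL hvalpos.ne' ?_
    have hcont : Tendsto (fun s : ℝ => z + s • e0) (𝓝 0) (𝓝 z) := by
      have : Continuous fun s : ℝ => z + s • e0 := by fun_prop
      simpa using this.tendsto 0
    exact (hcont.eventually hfeq).filter_mono nhdsWithin_le_nhds

/-! ## The toolkit (a registered helper stub) -/

/-- **The local-model toolkit of the seam normalisation** (registered helper stub of the line,
proved in this file): the local model `localModel` at a regular seam point. -/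
def SeamFormModelToolkit : Prop :=
  ∀ (σ g : EuclideanSpace ℝ (Fin 4) → ℝ) (Tg : Set (EuclideanSpace ℝ (Fin 4))), IsOpen Tg →
    ∀ (zc : EuclideanSpace ℝ (Fin 4)), zc ∈ Tg → zc 0 = 0 →
    ContDiffOn ℝ 1 σ Tg → ContDiffOn ℝ 1 g Tg →
    (∀ z ∈ Tg, 0 ≤ z 0 → σ z ≤ 0) → (∀ z ∈ Tg, z 0 = 0 → σ z = 0) → fderiv ℝ σ zc ≠ 0 →
    (∀ z ∈ Tg, z 0 ≤ 0 → g z ≤ 1) → (∀ z ∈ Tg, z 0 = 0 → g z = 1) → fderiv ℝ g zc ≠ 0 →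
    ∃ r : ℝ, 0 < r ∧ ball zc r ⊆ Tg ∧ ∃ η : ℝ, 0 < η ∧
      (∀ z ∈ ball zc r, (σ z = 0 ↔ z 0 = 0) ∧ (z 0 < 0 → 0 < σ z) ∧ (0 < z 0 → σ z < 0) ∧
        fderiv ℝ σ z ≠ 0 ∧ fderiv ℝ g z ≠ 0) ∧
      (∀ ψ : ℝ → ℝ, Differentiable ℝ ψ → (∀ t, 0 ≤ ψ t ∧ ψ t ≤ 1) →
        (∀ t, |t * deriv ψ t| ≤ η) → ∀ z ∈ ball zc r, ∀ f : EuclideanSpace ℝ (Fin 4) → ℝ,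
        DifferentiableAt ℝ f z → (f =ᶠ[𝓝 z] fun w => g w + ψ (σ w) * (1 - σ w - g w)) →
        fderiv ℝ f z ≠ 0)

/-- **Registered helper stub `stub_seamFormModelToolkit`** of line `lp-by-sphere-system-surgery`
(local model for the seam normalisation `stub_seamForm`). [cite: AbramsGayKirby2018, proof of Thm. 5] -/
theorem stub_seamFormModelToolkit : SeamFormModelToolkit :=
  fun _ _ _ hTg _ hzc hzc0 hσ hg hσle hσ0 hσ' hgle hg1 hg' =>
    localModel hTg hzc hzc0 hσ hg hσle hσ0 hσ' hgle hg1 hg'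

end Summit.SmoothPoincare4.SmoothPoincare4.Cruxes.AgkCor6Sufficiency.LpBySphereSystemSurgery

end
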